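import Literature.Analysis.UnboundedOperators.HeatKernelBoundedData
import Mathlib.Analysis.Calculus.ParametricIntegral
import Mathlib.MeasureTheory.Integral.IntervalIntegral.Periodic
import HarnessLib

/-!
# The caloric extension of data that are periodic and mean-zero along one direction

Analysis/UnboundedOperators support file (all results proved; no definitions, no named facts),
continuing `HeatKernelBoundedData` (caloric extension `e^{aΔ} g = heatExtension g a` of bounded
continuous data on a finite-dimensional real inner product space `E`, `n = finrank ℝ E`).

If `g : E → F` is bounded (`‖g‖ ≤ B`), continuous, periodic under the translation `y ↦ y + ℓ • e`
(`0 < ℓ`, `e : E` any vector) and has ZERO MEAN along `e`, `∫₀^ℓ g (y + s • e) ds = 0` for every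
`y`, then its caloric extension decays in the sup norm at the parabolic rate of ONE derivative:

  `‖e^{aΔ} g (x)‖ ≤ 2^{n/2} · a^{-1/2} · (ℓ B) · ‖e‖`   (`norm_heatExtension_le_of_periodic_meanZero`).

This is the Poincaré–Wirtinger gain of the periodic direction in parabolic form: the mean-zero
periodic datum is an exact derivative `g = ∂ₑ G` of the BOUNDED periodic primitive
`G y = ℓ⁻¹ ∫₀^ℓ s • g (y + s • e) ds` (`‖G‖ ≤ ℓ B`; `G (y + h • e) - G y = ∫₀ʰ g (y + s • e) ds`,
`periodicPrimitive_add_smul_sub`), so `e^{aΔ} g = ∂ₑ (e^{aΔ} G)` (differentiation under the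
integral sign, `heatExtension_eq_fderiv_heatExtension_primitive`) and the tree's sup bound for one
derivative of the caloric extension of bounded data,
`‖∂ᵥ e^{aΔ} G‖ ≤ 2^{n/2} a^{-1/2} (sup ‖G‖) ‖v‖` (`norm_fderiv_heatExtension_apply_le_of_bounded`,
Giga–Giga–Saal §1.1.3), finishes.  Standard (e.g. the decay `e^{tΔ}` on mean-zero functions of
the torus, here in the weak form `O(ℓ/√a)` that needs no Fourier analysis); recorded for the
Navier–Stokes Liouville argument for ancient solutions periodic in one direction
(route `ExtremiserTransience`, crux `NearExtremalTransiencePerFlow`, rung «periodic filaments»).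

## Mathlib / tree search

Tree: `heatExtension_apply`, `integrable_heatKernel_smul_of_bound`, `contDiff_heatExtension_of_bound`,
`norm_fderiv_heatExtension_apply_le_of_bounded`, `continuous_heatKernel`, `heatKernel_pos`,
`integrable_heatKernel_holds` (`HeatKernel*.lean`).  Mathlib: `hasDerivAt_integral_of_dominated_loc_of_deriv_le`,
`intervalIntegral.integral_hasDerivAt_right`, `Function.Periodic.intervalIntegral_add_eq`,
`intervalIntegral.integral_comp_add_right`, `intervalIntegral.continuous_parametric_intervalIntegral_of_continuous'`.
Nothing in the tree on mean-zero periodic data for `heatExtension` (`lean search 'heatExtension.*eriodic'`).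

## References

* Y. Giga, M.-H. Giga, J. Saal, *Nonlinear Partial Differential Equations — Asymptotic Behavior of
  Solutions and Self-Similar Solutions*, Birkhäuser 2010, §1.1.3 (`L^p`–`L^q` and derivative
  estimates for `e^{tΔ}`). [GigaGigaSaal2010]
* L. C. Evans, *Partial Differential Equations*, AMS 2010, §2.3.1 (the heat kernel), §5.8.1
  (Poincaré–Wirtinger). [Evans2010]
-/

noncomputable section

open MeasureTheory Set Function Filter Topology Metric intervalIntegral
open scoped InnerProductSpace RealInnerProductSpace ENNReal NNReal

namespace Literature.Analysis.UnboundedOperators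

variable {E : Type*} [NormedAddCommGroup E] [InnerProductSpace ℝ E] [FiniteDimensional ℝ E]
  [MeasurableSpace E] [BorelSpace E]
variable {F : Type*} [NormedAddCommGroup F] [NormedSpace ℝ F] [CompleteSpace F]

/-! ### The bounded periodic primitive along `e` of a mean-zero periodic datum -/

omit [InnerProductSpace ℝ E] [FiniteDimensional ℝ E] [MeasurableSpace E] [BorelSpace E]
  [NormedAddCommGroup F] [NormedSpace ℝ F] [CompleteSpace F] in
/-- Along the line `s ↦ y + s • e` a datum periodic under `y ↦ y + ℓ • e` is an `ℓ`-periodic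
function of `s`. [folklore] -/
private theorem periodic_line [NormedSpace ℝ E] {g : E → F} {e : E} {ℓ : ℝ}
    (hper : ∀ y, g (y + ℓ • e) = g y) (y : E) : Periodic (fun s : ℝ => g (y + s • e)) ℓ := by
  intro s
  simp only
  rw [add_smul, ← add_assoc, hper]

omit [InnerProductSpace ℝ E] [FiniteDimensional ℝ E] [MeasurableSpace E] [BorelSpace E] [CompleteSpace F] in
/-- **The periodic primitive.**  For continuous `g` periodic under `y ↦ y + ℓ • e` with zero mean
along `e`, the bounded function `G y = ℓ⁻¹ • ∫₀^ℓ s • g (y + s • e) ds` is a primitive of `g` along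
`e`: `G (y + h • e) - G y = ∫₀ʰ g (y + s • e) ds` for all `y`, `h`.  (Shift the window:
`∫₀^ℓ s g(y + (s+h)e) ds = ∫ₕ^{h+ℓ} (u - h) g(y + u e) du`, the `h`-term vanishes by the zero mean,
and `∫ₕ^{h+ℓ} u g - ∫₀^ℓ u g = ∫₀ʰ ((u+ℓ) - u) g(y + u e) du = ℓ ∫₀ʰ g` by periodicity.)
Evans, *PDE*, §5.8.1 (Poincaré–Wirtinger in one variable). [folklore] -/
private theorem periodicPrimitive_add_smul_sub [NormedSpace ℝ E] {g : E → F} (hg : Continuous g) {e : E}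
    {ℓ : ℝ} (hℓ : 0 < ℓ) (hper : ∀ y, g (y + ℓ • e) = g y)
    (hmean : ∀ y, ∫ s in (0 : ℝ)..ℓ, g (y + s • e) = 0) (y : E) (h : ℝ) :
    (ℓ⁻¹ • ∫ s in (0 : ℝ)..ℓ, s • g (y + h • e + s • e)) - ℓ⁻¹ • ∫ s in (0 : ℝ)..ℓ, s • g (y + s • e)
      = ∫ s in (0 : ℝ)..h, g (y + s • e) := by
  -- the line function `ψ s = g (y + s • e)` and its periodicity
  set ψ : ℝ → F := fun s => g (y + s • e) with hψ
  have hψc : Continuous ψ := hg.comp (continuous_const.add (continuous_id.smul continuous_const))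
  have hψp : Periodic ψ ℓ := periodic_line hper y
  have hsc : Continuous fun s : ℝ => s • ψ s := continuous_id.smul hψc
  have hi : ∀ a b : ℝ, IntervalIntegrable ψ volume a b := fun a b => hψc.intervalIntegrable a b
  have his : ∀ a b : ℝ, IntervalIntegrable (fun s : ℝ => s • ψ s) volume a b := fun a b =>
    hsc.intervalIntegrable a b
  have hic : ∀ (c : ℝ) (a b : ℝ), IntervalIntegrable (fun s : ℝ => c • ψ s) volume a b := fun c a b =>
    (continuous_const.smul hψc).intervalIntegrable a b
  -- the integrand after the shift `s ↦ s + h`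
  have hshift : (∫ s in (0 : ℝ)..ℓ, s • g (y + h • e + s • e)) = ∫ u in h..h + ℓ, (u - h) • ψ u := by
    have h1 : (fun s : ℝ => s • g (y + h • e + s • e)) = fun s => ((s + h) - h) • ψ (s + h) := by
      funext s
      simp only [hψ, add_sub_cancel_right]
      rw [add_assoc, ← add_smul, add_comm h s]
    rw [h1, intervalIntegral.integral_comp_add_right (fun u => (u - h) • ψ u) h, zero_add, add_comm ℓ h]
  -- zero mean over every period
  have hmean' : ∫ u in h..h + ℓ, ψ u = 0 := by
    rw [hψp.intervalIntegral_add_eq h 0, zero_add]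
    exact hmean y
  -- split `(u - h) • ψ u = u • ψ u - h • ψ u`
  have hsplit : (∫ u in h..h + ℓ, (u - h) • ψ u) = ∫ u in h..h + ℓ, u • ψ u := by
    have h2 : (fun u : ℝ => (u - h) • ψ u) = fun u => u • ψ u - h • ψ u := by
      funext u; rw [sub_smul]
    rw [h2, intervalIntegral.integral_sub (his _ _) (hic h _ _),
      intervalIntegral.integral_smul, hmean', smul_zero, sub_zero]
  -- `∫ₕ^{h+ℓ} u ψ = -∫₀ʰ u ψ + ∫₀^ℓ u ψ + ∫_ℓ^{ℓ+h} u ψ` and `∫_ℓ^{ℓ+h} u ψ = ∫₀ʰ (u + ℓ) ψ`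
  have hwin : (∫ u in h..h + ℓ, u • ψ u) - ∫ u in (0 : ℝ)..ℓ, u • ψ u
      = ∫ u in (0 : ℝ)..h, ℓ • ψ u := by
    have h3 : (∫ u in h..h + ℓ, u • ψ u) = (∫ u in h..(0 : ℝ), u • ψ u) + ∫ u in (0 : ℝ)..h + ℓ, u • ψ u :=
      (intervalIntegral.integral_add_adjacent_intervals (his _ _) (his _ _)).symm
    have h4 : (∫ u in (0 : ℝ)..h + ℓ, u • ψ u) = (∫ u in (0 : ℝ)..ℓ, u • ψ u) + ∫ u in ℓ..h + ℓ, u • ψ u :=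
      (intervalIntegral.integral_add_adjacent_intervals (his _ _) (his _ _)).symm
    have h5 : (∫ u in ℓ..h + ℓ, u • ψ u) = ∫ u in (0 : ℝ)..h, (u + ℓ) • ψ u := by
      have h6 : (fun u : ℝ => (u + ℓ) • ψ u) = fun u => (u + ℓ) • ψ (u + ℓ) := by
        funext u; rw [hψp u]
      rw [h6, intervalIntegral.integral_comp_add_right (fun u => u • ψ u) ℓ, zero_add, add_comm h ℓ]
    have h7 : (∫ u in h..(0 : ℝ), u • ψ u) = -∫ u in (0 : ℝ)..h, u • ψ u :=
      intervalIntegral.integral_symm _ _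
    rw [h3, h4, h5, h7]
    have h8 : (∫ u in (0 : ℝ)..h, (u + ℓ) • ψ u) = (∫ u in (0 : ℝ)..h, u • ψ u) + ∫ u in (0 : ℝ)..h, ℓ • ψ u := by
      rw [← intervalIntegral.integral_add (his _ _) (hic ℓ _ _)]
      congr 1; funext u; rw [add_smul]
    rw [h8]; abel
  -- assemble
  rw [← smul_sub, hshift, hsplit, hwin, intervalIntegral.integral_smul, smul_smul,
    inv_mul_cancel₀ hℓ.ne', one_smul]

omit [InnerProductSpace ℝ E] [FiniteDimensional ℝ E] [MeasurableSpace E] [BorelSpace E] [CompleteSpace F] in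
/-- The periodic primitive is bounded: `‖ℓ⁻¹ • ∫₀^ℓ s • g (y + s • e) ds‖ ≤ ℓ B` if `‖g‖ ≤ B`,
`0 < ℓ`. [folklore] -/
private theorem norm_periodicPrimitive_le [NormedSpace ℝ E] {g : E → F} {B : ℝ} (hB : ∀ z, ‖g z‖ ≤ B)
    {e : E} {ℓ : ℝ} (hℓ : 0 < ℓ) (y : E) :
    ‖ℓ⁻¹ • ∫ s in (0 : ℝ)..ℓ, s • g (y + s • e)‖ ≤ ℓ * B := by
  have hB0 : 0 ≤ B := (norm_nonneg _).trans (hB y)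
  have hbound : ∀ s ∈ Set.uIoc (0 : ℝ) ℓ, ‖s • g (y + s • e)‖ ≤ ℓ * B := by
    intro s hs
    rw [uIoc_of_le hℓ.le] at hs
    rw [norm_smul, Real.norm_of_nonneg hs.1.le]
    exact mul_le_mul hs.2 (hB _) (norm_nonneg _) hℓ.le
  have h1 := intervalIntegral.norm_integral_le_of_norm_le_const hbound
  rw [sub_zero, abs_of_pos hℓ] at h1
  rw [norm_smul, norm_inv, Real.norm_of_nonneg hℓ.le]
  calc ℓ⁻¹ * ‖∫ s in (0 : ℝ)..ℓ, s • g (y + s • e)‖ ≤ ℓ⁻¹ * (ℓ * B * ℓ) := by gcongr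
    _ = ℓ * B := by field_simp

omit [InnerProductSpace ℝ E] [FiniteDimensional ℝ E] [MeasurableSpace E] [BorelSpace E] [CompleteSpace F] in
/-- The periodic primitive of continuous data is continuous. [folklore] -/
private theorem continuous_periodicPrimitive [NormedSpace ℝ E] {g : E → F} (hg : Continuous g) (e : E) (ℓ : ℝ) :
    Continuous fun y : E => ℓ⁻¹ • ∫ s in (0 : ℝ)..ℓ, s • g (y + s • e) := by
  have hu : Continuous (uncurry fun (y : E) (s : ℝ) => s • g (y + s • e)) :=
    continuous_snd.smul (hg.comp (continuous_fst.add (continuous_snd.smul continuous_const)))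
  exact (intervalIntegral.continuous_parametric_intervalIntegral_of_continuous' (μ := volume) hu 0 ℓ).const_smul _

omit [InnerProductSpace ℝ E] [FiniteDimensional ℝ E] [MeasurableSpace E] [BorelSpace E] in
/-- The periodic primitive is differentiable along `e` with derivative the datum:
`d/dh G (y + h • e) = g (y + h • e)`. [folklore] -/
private theorem hasDerivAt_periodicPrimitive_line [NormedSpace ℝ E] {g : E → F} (hg : Continuous g) {e : E}
    {ℓ : ℝ} (hℓ : 0 < ℓ) (hper : ∀ y, g (y + ℓ • e) = g y)
    (hmean : ∀ y, ∫ s in (0 : ℝ)..ℓ, g (y + s • e) = 0) (y : E) (h₀ : ℝ) :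
    HasDerivAt (fun h : ℝ => ℓ⁻¹ • ∫ s in (0 : ℝ)..ℓ, s • g (y + h • e + s • e)) (g (y + h₀ • e)) h₀ := by
  have hψc : Continuous fun s : ℝ => g (y + s • e) :=
    hg.comp (continuous_const.add (continuous_id.smul continuous_const))
  -- `G (y + h e) = G y + ∫₀ʰ g (y + s e) ds`
  have heq : (fun h : ℝ => ℓ⁻¹ • ∫ s in (0 : ℝ)..ℓ, s • g (y + h • e + s • e))
      = fun h => (ℓ⁻¹ • ∫ s in (0 : ℝ)..ℓ, s • g (y + s • e)) + ∫ s in (0 : ℝ)..h, g (y + s • e) := by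
    funext h
    rw [← periodicPrimitive_add_smul_sub hg hℓ hper hmean y h, add_sub_cancel]
  rw [heq]
  refine HasDerivAt.const_add _ ?_
  exact intervalIntegral.integral_hasDerivAt_right (hψc.intervalIntegrable _ _)
    (hψc.stronglyMeasurableAtFilter _ _) hψc.continuousAt

/-! ### The caloric extension of a mean-zero periodic datum -/

/-- **`e^{aΔ} g = ∂ₑ (e^{aΔ} G)` for a mean-zero periodic datum** `g` and its bounded periodic
primitive `G y = ℓ⁻¹ • ∫₀^ℓ s • g (y + s • e) ds`: differentiate `h ↦ e^{aΔ} G (x + h • e) =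
∫ G_a(y) • G(x + h • e - y) dy` under the integral sign (dominated by `G_a · sup ‖g‖`) and compare
with the chain rule. [folklore] -/
private theorem heatExtension_eq_fderiv_heatExtension_primitive {g : E → F} (hg : Continuous g) {B : ℝ}
    (hB : ∀ z, ‖g z‖ ≤ B) {e : E} {ℓ : ℝ} (hℓ : 0 < ℓ) (hper : ∀ y, g (y + ℓ • e) = g y)
    (hmean : ∀ y, ∫ s in (0 : ℝ)..ℓ, g (y + s • e) = 0) {a : ℝ} (ha : 0 < a) (x : E) :
    heatExtension g a x =
      fderiv ℝ (heatExtension (fun y => ℓ⁻¹ • ∫ s in (0 : ℝ)..ℓ, s • g (y + s • e)) a) x e := by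
  set G : E → F := fun y => ℓ⁻¹ • ∫ s in (0 : ℝ)..ℓ, s • g (y + s • e) with hGdef
  have hGc : Continuous G := continuous_periodicPrimitive hg e ℓ
  have hGb : ∀ z, ‖G z‖ ≤ ℓ * B := fun z => norm_periodicPrimitive_le hB hℓ z
  have hB0 : 0 ≤ B := (norm_nonneg _).trans (hB x)
  -- the path `Φ h = e^{aΔ} G (x + h • e) = ∫ G_a(y) • G (x + h • e - y) dy`
  have hΦ : ∀ h : ℝ, heatExtension G a (x + h • e) = ∫ y, heatKernel a y • G (x + h • e - y) :=
    fun h => heatExtension_apply G a (x + h • e)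
  -- derivative along `e` of `G`, at the points `x + h • e - y = (x - y) + h • e`
  have hGd : ∀ (y : E) (h : ℝ), HasDerivAt (fun h : ℝ => G (x + h • e - y)) (g (x + h • e - y)) h := by
    intro y h
    have h1 := hasDerivAt_periodicPrimitive_line hg hℓ hper hmean (x - y) h
    have e1 : ∀ h' : ℝ, x + h' • e - y = x - y + h' • e := fun h' => add_sub_right_comm x (h' • e) y
    simp only [e1]
    exact h1
  -- differentiation under the integral sign
  have hkey : HasDerivAt (fun h : ℝ => ∫ y, heatKernel a y • G (x + h • e - y))
      (∫ y, heatKernel a y • g (x + (0 : ℝ) • e - y)) 0 := by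
    have hF_meas : ∀ᶠ h in 𝓝 (0 : ℝ), AEStronglyMeasurable (fun y => heatKernel a y • G (x + h • e - y)) volume :=
      Eventually.of_forall fun h =>
        ((continuous_heatKernel a).smul (hGc.comp (continuous_const.sub continuous_id))).aestronglyMeasurable
    have hF_int : Integrable (fun y => heatKernel a y • G (x + (0 : ℝ) • e - y)) volume :=
      integrable_heatKernel_smul_of_bound hGc hGb ha _
    have hF'_meas : AEStronglyMeasurable (fun y => heatKernel a y • g (x + (0 : ℝ) • e - y)) volume :=
      ((continuous_heatKernel a).smul (hg.comp (continuous_const.sub continuous_id))).aestronglyMeasurable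
    have h_bound : ∀ᵐ y ∂(volume : Measure E), ∀ h ∈ (univ : Set ℝ),
        ‖heatKernel a y • g (x + h • e - y)‖ ≤ heatKernel a y * B :=
      Eventually.of_forall fun y h _ => by
        rw [norm_smul, Real.norm_of_nonneg (heatKernel_pos ha y).le]
        exact mul_le_mul_of_nonneg_left (hB _) (heatKernel_pos ha y).le
    have hbi : Integrable (fun y : E => heatKernel a y * B) (volume : Measure E) :=
      (integrable_heatKernel_holds ha).mul_const B
    have h_diff : ∀ᵐ y ∂(volume : Measure E), ∀ h ∈ (univ : Set ℝ),
        HasDerivAt (fun h : ℝ => heatKernel a y • G (x + h • e - y)) (heatKernel a y • g (x + h • e - y)) h :=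
      Eventually.of_forall fun y h _ => (hGd y h).const_smul (heatKernel a y)
    exact (hasDerivAt_integral_of_dominated_loc_of_deriv_le (μ := volume) univ_mem hF_meas hF_int hF'_meas
      h_bound hbi h_diff).2
  have hkey' : HasDerivAt (fun h : ℝ => heatExtension G a (x + h • e)) (heatExtension g a x) 0 := by
    have e2 : heatExtension g a x = ∫ y, heatKernel a y • g (x + (0 : ℝ) • e - y) := by
      rw [heatExtension_apply]; simp
    rw [e2]
    have e3 : (fun h : ℝ => heatExtension G a (x + h • e)) = fun h => ∫ y, heatKernel a y • G (x + h • e - y) :=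
      funext hΦ
    rw [e3]; exact hkey
  -- the chain rule
  have hchain : HasDerivAt (fun h : ℝ => heatExtension G a (x + h • e)) (fderiv ℝ (heatExtension G a) x e) 0 := by
    have hd : DifferentiableAt ℝ (heatExtension G a) x :=
      ((contDiff_heatExtension_of_bound hGc hGb ha (m := 1)).differentiable (by simp)).differentiableAt
    have hline : HasDerivAt (fun h : ℝ => x + h • e) e 0 := by
      simpa using ((hasDerivAt_id (0 : ℝ)).smul_const e).const_add x
    have hcomp := hd.hasFDerivAt.comp_hasDerivAt_of_eq (0 : ℝ) hline (by simp)
    have e4 : (fun h : ℝ => heatExtension G a (x + h • e)) = heatExtension G a ∘ fun h : ℝ => x + h • e := rfl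
    rw [e4]
    exact hcomp
  exact hkey'.unique hchain

/-- **Sup-norm decay of the caloric extension of a mean-zero periodic datum.**  If `g : E → F` is
continuous, `‖g‖ ≤ B`, periodic under `y ↦ y + ℓ • e` (`0 < ℓ`) and `∫₀^ℓ g (y + s • e) ds = 0`
for every `y`, then `‖e^{aΔ} g (x)‖ ≤ 2^{n/2} a^{-1/2} (ℓ B) ‖e‖` for all `0 < a`, `x`
(`n = finrank ℝ E`): one parabolic derivative of gain from the periodic direction.
Giga–Giga–Saal 2010, §1.1.3 (derivative estimate), with Evans §5.8.1. [cite: GigaGigaSaal2010, §1.1.3] -/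
theorem norm_heatExtension_le_of_periodic_meanZero {g : E → F} (hg : Continuous g) {B : ℝ}
    (hB : ∀ z, ‖g z‖ ≤ B) {e : E} {ℓ : ℝ} (hℓ : 0 < ℓ) (hper : ∀ y, g (y + ℓ • e) = g y)
    (hmean : ∀ y, ∫ s in (0 : ℝ)..ℓ, g (y + s • e) = 0) {a : ℝ} (ha : 0 < a) (x : E) :
    ‖heatExtension g a x‖ ≤
      (2 : ℝ) ^ ((Module.finrank ℝ E : ℝ) / 2) * a ^ (-(1 / 2 : ℝ)) * (ℓ * B) * ‖e‖ := by
  rw [heatExtension_eq_fderiv_heatExtension_primitive hg hB hℓ hper hmean ha x]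
  exact norm_fderiv_heatExtension_apply_le_of_bounded
    (continuous_periodicPrimitive hg e ℓ).aestronglyMeasurable
    (fun z => norm_periodicPrimitive_le hB hℓ z) ha x e

/-- The same bound with the mean-zero hypothesis phrased over an ARBITRARY window of one period,
`∫ₜ^{t+ℓ} g (y + s • e) ds = 0` for some `t` (periodicity makes the window irrelevant). [cite: GigaGigaSaal2010, §1.1.3] -/
theorem norm_heatExtension_le_of_periodic_meanZero' {g : E → F} (hg : Continuous g) {B : ℝ}
    (hB : ∀ z, ‖g z‖ ≤ B) {e : E} {ℓ : ℝ} (hℓ : 0 < ℓ) (hper : ∀ y, g (y + ℓ • e) = g y)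
    {t : ℝ} (hmean : ∀ y, ∫ s in t..t + ℓ, g (y + s • e) = 0) {a : ℝ} (ha : 0 < a) (x : E) :
    ‖heatExtension g a x‖ ≤
      (2 : ℝ) ^ ((Module.finrank ℝ E : ℝ) / 2) * a ^ (-(1 / 2 : ℝ)) * (ℓ * B) * ‖e‖ := by
  refine norm_heatExtension_le_of_periodic_meanZero hg hB hℓ hper (fun y => ?_) ha x
  have h := (periodic_line hper y).intervalIntegral_add_eq 0 t
  rw [zero_add] at h
  rw [h]; exact hmean y

/-- **Translate-minus-self form** (the shape used in Liouville arguments for solutions periodic in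
one direction): for continuous `f` periodic under `y ↦ y + ℓ • e` (`0 < ℓ`) and any shift `h`, the
difference `g = f (· + h • e) - f` is periodic and mean-zero along `e`, so
`‖e^{aΔ} (f(· + h • e) - f) (x)‖ ≤ 2^{n/2} a^{-1/2} (ℓ S) ‖e‖` whenever `‖f (z + h • e) - f z‖ ≤ S`.
Giga–Giga–Saal 2010, §1.1.3 (derivative estimate), with Evans §5.8.1. [cite: GigaGigaSaal2010, §1.1.3] -/
theorem norm_heatExtension_translate_sub_le_of_periodic {f : E → F} (hf : Continuous f) {e : E} {ℓ : ℝ}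
    (hℓ : 0 < ℓ) (hper : ∀ y, f (y + ℓ • e) = f y) (h : ℝ) {S : ℝ}
    (hS : ∀ z, ‖f (z + h • e) - f z‖ ≤ S) {a : ℝ} (ha : 0 < a) (x : E) :
    ‖heatExtension (fun y => f (y + h • e) - f y) a x‖ ≤
      (2 : ℝ) ^ ((Module.finrank ℝ E : ℝ) / 2) * a ^ (-(1 / 2 : ℝ)) * (ℓ * S) * ‖e‖ := by
  have hg : Continuous fun y => f (y + h • e) - f y :=
    (hf.comp (continuous_id.add continuous_const)).sub hf
  have hgper : ∀ y, (fun y => f (y + h • e) - f y) (y + ℓ • e) = (fun y => f (y + h • e) - f y) y := by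
    intro y
    simp only
    rw [add_right_comm, hper, hper]
  have hgmean : ∀ y, ∫ s in (0 : ℝ)..ℓ, (fun y => f (y + h • e) - f y) (y + s • e) = 0 := by
    intro y
    have hψc : Continuous fun s : ℝ => f (y + s • e) :=
      hf.comp (continuous_const.add (continuous_id.smul continuous_const))
    have hψp : Periodic (fun s : ℝ => f (y + s • e)) ℓ := periodic_line hper y
    have h1 : (fun s : ℝ => (fun y => f (y + h • e) - f y) (y + s • e))
        = fun s => f (y + (s + h) • e) - f (y + s • e) := by
      funext s
      simp only
      rw [add_smul, ← add_assoc]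
    have hi1 : IntervalIntegrable (fun s : ℝ => f (y + (s + h) • e)) volume 0 ℓ :=
      (hf.comp (continuous_const.add ((continuous_id.add continuous_const).smul
        continuous_const))).intervalIntegrable _ _
    rw [h1, intervalIntegral.integral_sub hi1 (hψc.intervalIntegrable _ _),
      intervalIntegral.integral_comp_add_right (fun s => f (y + s • e)) h,
      zero_add, add_comm ℓ h, hψp.intervalIntegral_add_eq h 0, zero_add, sub_self]
  exact norm_heatExtension_le_of_periodic_meanZero hg hS hℓ hgper hgmean ha x

end Literature.Analysis.UnboundedOperators

end
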